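import Mathlib
import Summits.ValiantsHypothesis.ValiantsHypothesis.Theses.LacunarySymmetroid
import Summits.ValiantsHypothesis.ValiantsHypothesis.Theorems.SymmetroidDescartesThetaPencilWitnessTheta
import Summits.ValiantsHypothesis.ValiantsHypothesis.Theorems.FeketeSOSSOSMagnificationStubVnpAssembly
import Literature.Computability.AlgebraicComplexity.RealTauConjectureViaVnProofs
import Literature.Computability.AlgebraicComplexity.VNPClosedUnderProjection
import Literature.Computability.AlgebraicComplexity.ValiantConjectureProofs
import Literature.Computability.AlgebraicComplexity.ArithCircuitProofs
import Literature.Computability.AlgebraicComplexity.TavenasHutchinsonFamily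

/-!
# Route LacunarySymmetroid — crux `ThetaWitness` (stmt-ValiantsHypothesis-18052)

`Summit.ValiantsHypothesis.ValiantsHypothesis.Theses.LacunarySymmetroid.ThetaWitness`: there are a
real family `Θ_n ∈ ℝ[y_0, …, y_{n-1}]` whose complexification is a `VNP` family and exponents
`d_{n,i}` such that, eventually in `n`, the restriction `Θ_n(X^{d_{n,0}}, …, X^{d_{n,n-1}})` has at
least `2^{n⌊log₂ n⌋} - 1` distinct real zeros.

## The witness (Tavenas' `P`-definable Hutchinson family, re-based from bits to digits)

Put `L = ⌊log₂ n⌋`, `ν = n L`, `β = 2L + 3`.  Tavenas' Cor. 3.37 (tree theorem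
`Tavenas2014_cor_3_37_holds`) gives a multilinear `h_ν ∈ ℚ[x_0..x_{2ν+2}, z_0..z_{2ν+2}]`, a
projection of `PER_{q(ν)}` with `q` p-bounded, such that
`h_ν(X^{2^j}; 2^{2^i}) = V_ν = Σ_{i<2^ν} 2^{2i(2^ν-1-i)} X^i` (`tavenasV ν`), a polynomial with
`2^ν - 1` distinct real roots (`le_card_roots_toFinset_map_tavenasV`, Tavenas 2014 Lemme 3.36 via
Hutchinson's dominant-term argument).  The DIGIT substitution

  `x_j ↦ y_{⌊j/β⌋}^{2^{j mod β}}`   (`⌊j/β⌋ < n` because `2ν + 3 ≤ β n` for `n ≥ 1`),   `z_i ↦ 2^{2^i}`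

turns `h_ν ⊗ ℝ` into `Θ_n ∈ ℝ[y_0, …, y_{n-1}]`, and along the monomial curve `y_i = X^{2^{β i}}`
one has `x_j ↦ X^{2^{β⌊j/β⌋ + (j mod β)}} = X^{2^j}`, so `Θ_n(X^{d_{n,i}}) = V_ν` with
`d_{n,i} = 2^{β i}`: `2^{nL} - 1` distinct real zeros at every `n ≥ 1`.

`VNP`: `h_ν ⊗ ℂ` is a projection of `PER_{q(ν)}` over `ℂ` (`isProjection_map`, `map_perPoly`),
`PER ∈ VNP_ℂ` (`isVNPFamily_perPoly_holds`) and `VNP` is closed under p-projections among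
p-families (`IsVNPFamily.of_isPProjection_holds`), so `n ↦ h_{ν(n)} ⊗ ℂ` is a `VNP` family; and
`VNP` is closed under substitutions of p-bounded cost and degree (`isVNPFamily_aeval_of_isPBounded`
below: the Boolean sum commutes with a substitution of the genuine variables,
`boolSum_aeval_sumElim`; Bürgisser's substitution bound `complexity_aeval_le`; degrees multiply,
`totalDegree_aeval_le_mul`), each `y^{2^s}` costing `≤ 2^β ≤ 8n²` gates (constants are free in
Valiant's model, Bürgisser 2000 Def. 2.1).  The complexification of `Θ_n` is literally this
substituted family (`map_bind₁`).

References: S. Tavenas, PhD thesis (ENS Lyon 2014), Lemme 3.36, Cor. 3.37;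
P. Bürgisser, *Completeness and Reduction in Algebraic Complexity Theory* (2000), §2.1, Rem. 2.7;
J. I. Hutchinson, Trans. AMS 25 (1923).
-/

noncomputable section

-- single-conjunct layout: Sub = Summit, duplicated namespace component intended
set_option linter.dupNamespace false

namespace Summit.ValiantsHypothesis.ValiantsHypothesis.Theorems.LacunarySymmetroid

open MvPolynomial Literature.Computability.AlgebraicComplexity
open Summit.ValiantsHypothesis.ValiantsHypothesis.Theorems.SymmetroidDescartes
  (isProjection_map complexity_pow_le totalDegree_aeval_le_mul eval_map_tavenas_h)
open Summit.ValiantsHypothesis.ValiantsHypothesis.Theorems.FeketeSOSSOSMagnification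
  (isVNPFamily_of_levelwise' boolSum_aeval_sumElim)

universe v w

/-! ### `VNP` is closed under p-bounded substitutions -/

/-- **`VNP_ℂ` is closed under substitutions of p-bounded cost and degree** (Bürgisser 2000, §2.1
with Rem. 2.7): if `f ∈ VNP` over `ℂ`, `f_n = Σ_e G_n(x, e)` with `G ∈ VP`, and `a_n` substitutes
polynomials in the variables `τ n` for the variables of `f_n`, with `#(τ n)`, the total cost
`Σ_v L(a_n v)` and every degree `deg (a_n v)` at most `B n` for a p-bounded `B`, then
`(f_n(a_n))_n ∈ VNP`: the Boolean sum commutes with the substitution of the genuine variables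
(`boolSum_aeval_sumElim`), the substituted witness costs `≤ L(G_n) + Σ_v L(a_n v)`
(`complexity_aeval_le`, `complexity_rename_le`) and has degree `≤ (B n + 1) · deg G_n`
(`totalDegree_aeval_le_mul`). -/
theorem isVNPFamily_aeval_of_isPBounded {σ : ℕ → Type v} {τ : ℕ → Type w}
    [∀ n, Fintype (σ n)] [∀ n, Fintype (τ n)]
    {f : ∀ n, MvPolynomial (σ n) ℂ} (hf : IsVNPFamily f)
    (a : ∀ n, σ n → MvPolynomial (τ n) ℂ) {B : ℕ → ℕ} (hB : IsPBounded B)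
    (hcard : ∀ n, Fintype.card (τ n) ≤ B n) (hcx : ∀ n, ∑ v, complexity (a n v) ≤ B n)
    (hdeg : ∀ n v, (a n v).totalDegree ≤ B n) :
    IsVNPFamily (fun n => aeval (a n) (f n)) := by
  obtain ⟨⟨-, hfdeg⟩, u, G, ⟨⟨hGcard, hGdeg⟩, hGcx⟩, hfG⟩ := hf
  have hPF : IsPFamily (fun n => aeval (a n) (f n)) :=
    ⟨hB.mono hcard, (IsPBounded.mul_holds hB hfdeg).mono fun n =>
      totalDegree_aeval_le_mul (a n) (f n) (fun v => hdeg n v)⟩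
  refine isVNPFamily_of_levelwise'
    (B := fun n => Fintype.card (σ n ⊕ Fin (u n)) + (complexity (G n) + B n) +
      (B n + 1) * (G n).totalDegree) hPF
    (IsPBounded.add_holds (IsPBounded.add_holds hGcard (IsPBounded.add_holds hGcx hB))
      (IsPBounded.mul_holds (IsPBounded.add_holds hB (IsPBounded.const 1)) hGdeg)) fun n => ?_
  -- the substituted witness at level `n`: genuine variables substituted, Boolean ones kept
  let s : σ n ⊕ Fin (u n) → MvPolynomial (τ n ⊕ Fin (u n)) ℂ :=
    Sum.elim (fun v => rename Sum.inl (a n v)) (fun j => X (Sum.inr j))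
  refine ⟨u n, aeval s (G n), ?_, ?_, ?_, ?_⟩
  · -- its Boolean sum is `f_n(a_n)`
    rw [hfG n]
    exact boolSum_aeval_sumElim (a n) (G n)
  · -- length of the Boolean sum
    have h1 : u n ≤ Fintype.card (σ n ⊕ Fin (u n)) := by
      rw [Fintype.card_sum, Fintype.card_fin]
      exact Nat.le_add_left _ _
    exact h1.trans ((Nat.le_add_right _ _).trans (Nat.le_add_right _ _))
  · -- cost of the substituted witness
    have h1 := complexity_aeval_le (G n) s
    have h2 : ∑ v, complexity (s v) ≤ B n := by
      rw [Fintype.sum_sum_type]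
      have hl : ∀ v, complexity (s (Sum.inl v)) ≤ complexity (a n v) := fun v =>
        complexity_rename_le_holds' Sum.inl (a n v)
      have hr : ∀ j, complexity (s (Sum.inr j)) = 0 := fun j => complexity_X_holds _
      simp only [hr, Finset.sum_const_zero, add_zero]
      exact (Finset.sum_le_sum fun v _ => hl v).trans (hcx n)
    calc complexity (aeval s (G n)) ≤ complexity (G n) + B n := h1.trans (Nat.add_le_add_left h2 _)
      _ ≤ _ := (Nat.le_add_left _ _).trans (Nat.le_add_right _ _)
  · -- degree of the substituted witness
    have h1 : (aeval s (G n)).totalDegree ≤ (B n + 1) * (G n).totalDegree :=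
      totalDegree_aeval_le_mul s (G n) fun x => by
        rcases x with v | j
        · exact (totalDegree_rename_le _ _).trans ((hdeg n v).trans (Nat.le_succ _))
        · show (X (Sum.inr j) : MvPolynomial (τ n ⊕ Fin (u n)) ℂ).totalDegree ≤ B n + 1
          rw [totalDegree_X]
          exact Nat.le_add_left _ _
    exact h1.trans (Nat.le_add_left _ _)

/-! ### Projections of the permanent, base-changed to `ℂ` -/

/-- **Base-changed projections of `PER` form a `VNP_ℂ` family**: if `h_n ∈ ℚ[σ n]` is a projection
of `PER_{q n}` with `q` and `#(σ n)` p-bounded, then `(h_n ⊗ ℂ)_n ∈ VNP_ℂ` — projections commute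
with base change (`isProjection_map`, `map_perPoly`), `PER ∈ VNP` over every field
(`isVNPFamily_perPoly_holds`; Valiant 1979, Bürgisser 2000 Thm. 2.10), `VNP` is closed under
p-projections among p-families (`IsVNPFamily.of_isPProjection_holds`; Bürgisser 2000 §2.1), and
`deg h_n ≤ deg PER_{q n} ≤ q n`. -/
theorem isVNPFamily_map_of_isProjection_perPoly {σ : ℕ → Type v} [∀ n, Fintype (σ n)]
    {q : ℕ → ℕ} (hq : IsPBounded q) (hcard : IsPBounded fun n => Fintype.card (σ n))
    (h : ∀ n, MvPolynomial (σ n) ℚ) (hproj : ∀ n, IsProjection (h n) (perPoly (Fin (q n)) ℚ)) :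
    IsVNPFamily (fun n => MvPolynomial.map (algebraMap ℚ ℂ) (h n)) := by
  have hprojC : ∀ n,
      IsProjection (MvPolynomial.map (algebraMap ℚ ℂ) (h n)) (perPoly (Fin (q n)) ℂ) := fun n => by
    have hp := isProjection_map (algebraMap ℚ ℂ) (hproj n)
    rwa [map_perPoly] at hp
  refine IsVNPFamily.of_isPProjection_holds ⟨hcard, hq.mono fun n => ?_⟩ ⟨q, hq, hprojC⟩
    (isVNPFamily_perPoly_holds ℂ)
  calc (MvPolynomial.map (algebraMap ℚ ℂ) (h n)).totalDegree
      ≤ (perPoly (Fin (q n)) ℂ).totalDegree := DefVNP.IsProjection.totalDegree_le_holds (hprojC n)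
    _ ≤ Fintype.card (Fin (q n)) := perPoly_isHomogeneous.totalDegree_le
    _ = q n := Fintype.card_fin _

/-! ### The digit substitution -/

/-- **The digit substitution** `x_j ↦ y_{⌊j/β⌋}^{2^{j mod β}}` (`x_j ↦ 0` if `⌊j/β⌋ ≥ n`),
`z_i ↦ 2^{2^i}`, from `m + m` variables into `ℝ[y_0, …, y_{n-1}]`: (i) after base change to `ℂ`
every substituted value costs `≤ 2^β` gates (`L(y^{2^s}) ≤ 2^s`, Bürgisser 2000 §2.1; constants
and variables are free), (ii) has degree `≤ 2^β`, and (iii) when `m ≤ β n` the monomial curve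
`y_i = x^{2^{β i}}` is carried to the Kronecker point `(x^{2^j}; 2^{2^i})` of Tavenas' display (3.1),
because `2^{β ⌊j/β⌋} · 2^{j mod β} = 2^j`. -/
theorem exists_digitSubst (n m β : ℕ) (hβ : 0 < β) :
    ∃ g : Fin m ⊕ Fin m → MvPolynomial (Fin n) ℝ,
      (∀ v, complexity (MvPolynomial.map (algebraMap ℝ ℂ) (g v)) ≤ 2 ^ β) ∧
      (∀ v, (MvPolynomial.map (algebraMap ℝ ℂ) (g v)).totalDegree ≤ 2 ^ β) ∧
      (m ≤ β * n → ∀ (x : ℝ) (v : Fin m ⊕ Fin m),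
        MvPolynomial.eval (fun i : Fin n => x ^ 2 ^ (β * (i : ℕ))) (g v) =
          Sum.elim (fun j : Fin m => x ^ 2 ^ (j : ℕ)) (fun i : Fin m => (2 : ℝ) ^ 2 ^ (i : ℕ)) v) := by
  have h2β : ∀ j : ℕ, 2 ^ (j % β) ≤ 2 ^ β := fun j =>
    Nat.pow_le_pow_right (by norm_num) (Nat.mod_lt _ hβ).le
  refine ⟨Sum.elim
      (fun j => if hj : (j : ℕ) / β < n then X ⟨(j : ℕ) / β, hj⟩ ^ 2 ^ ((j : ℕ) % β) else 0)
      (fun i => C ((2 : ℝ) ^ 2 ^ (i : ℕ))), ?_, ?_, ?_⟩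
  · -- (i) cost after base change
    rintro (j | i)
    · simp only [Sum.elim_inl]
      split_ifs with hj
      · rw [map_pow, map_X]
        refine (complexity_pow_le _ _).trans ?_
        rw [complexity_X_holds, mul_zero, zero_add]
        exact h2β j
      · rw [map_zero, ← C_0, complexity_C_holds]
        exact Nat.zero_le _
    · simp only [Sum.elim_inr]
      rw [map_C, complexity_C_holds]
      exact Nat.zero_le _
  · -- (ii) degree after base change
    rintro (j | i)
    · simp only [Sum.elim_inl]
      split_ifs with hj
      · rw [map_pow, map_X]
        refine (totalDegree_pow _ _).trans ?_
        rw [totalDegree_X, mul_one]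
        exact h2β j
      · rw [map_zero, totalDegree_zero]
        exact Nat.zero_le _
    · simp only [Sum.elim_inr]
      rw [map_C, totalDegree_C]
      exact Nat.zero_le _
  · -- (iii) the monomial curve goes to the Kronecker point
    rintro hm x (j | i)
    · have hj : (j : ℕ) / β < n :=
        (Nat.div_lt_iff_lt_mul hβ).2 (lt_of_lt_of_le j.2 (hm.trans_eq (Nat.mul_comm _ _)))
      simp only [Sum.elim_inl, dif_pos hj, map_pow, eval_X]
      rw [← pow_mul, ← pow_add, Nat.div_add_mod (j : ℕ) β]
    · simp only [Sum.elim_inr, eval_C]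

/-! ### The crux -/

/-- **Crux `ThetaWitness` of route LacunarySymmetroid** (stmt-ValiantsHypothesis-18052): there are a
real family `Θ_n` in `n` variables with `VNP` complexification and exponents `d_{n,i}` such that for
all `n ≥ 1` the restriction `Θ_n(X^{d_{n,i}})` has at least `2^{n⌊log₂n⌋} - 1` distinct real
zeros.  Witness: `Θ_n = h_ν ⊗ ℝ` (Tavenas' bit polynomial of `V_ν`, `ν = n⌊log₂n⌋`, Cor. 3.37) under
the digit substitution with `β = 2⌊log₂n⌋ + 3`, `d_{n,i} = 2^{β i}`; the restriction is `V_ν`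
(`2^ν - 1` distinct real roots, Lemme 3.36) and the complexification is a p-bounded substitution
instance of a p-projection of `PER`, hence in `VNP_ℂ`. -/
theorem thetaWitness_proof :
    Summit.ValiantsHypothesis.ValiantsHypothesis.Theses.LacunarySymmetroid.ThetaWitness := by
  unfold Summit.ValiantsHypothesis.ValiantsHypothesis.Theses.LacunarySymmetroid.ThetaWitness
  obtain ⟨q, hq, hh⟩ := Tavenas2014_cor_3_37_holds
  choose h hproj _ hsub using hh
  choose g hgcx hgdeg hgev using fun n : ℕ =>
    exists_digitSubst n (2 * (n * Nat.log 2 n) + 3) (2 * Nat.log 2 n + 3) (Nat.succ_pos _)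
  refine ⟨fun n => aeval (g n) (MvPolynomial.map (algebraMap ℚ ℝ) (h (n * Nat.log 2 n))),
    fun n i => 2 ^ ((2 * Nat.log 2 n + 3) * (i : ℕ)), ?_, 1, fun n hn => ?_⟩
  · /- VNP: the complexification is the substituted family over `ℂ` -/
    have hβ : ∀ n : ℕ, 2 ^ (2 * Nat.log 2 n + 3) ≤ 8 * (n * n) + 8 := by
      intro n
      rcases Nat.eq_zero_or_pos n with rfl | hn
      · simp
      · have h1 : 2 ^ Nat.log 2 n ≤ n := Nat.pow_log_le_self 2 hn.ne'
        calc 2 ^ (2 * Nat.log 2 n + 3) = 8 * (2 ^ Nat.log 2 n * 2 ^ Nat.log 2 n) := by ring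
          _ ≤ 8 * (n * n) + 8 := by nlinarith [Nat.mul_le_mul h1 h1]
    have hmap : ∀ n : ℕ, MvPolynomial.map (algebraMap ℝ ℂ)
        (aeval (g n) (MvPolynomial.map (algebraMap ℚ ℝ) (h (n * Nat.log 2 n)))) =
        aeval (fun v => MvPolynomial.map (algebraMap ℝ ℂ) (g n v))
          (MvPolynomial.map (algebraMap ℚ ℂ) (h (n * Nat.log 2 n))) := by
      intro n
      rw [aeval_eq_bind₁, aeval_eq_bind₁, map_bind₁, map_map]
      congr 2
    simp only [hmap]
    have hlog : IsPBounded (Nat.log 2) := IsPBounded.id.mono fun n => Nat.log_le_self 2 n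
    have hν : IsPBounded fun n => n * Nat.log 2 n := IsPBounded.mul_holds IsPBounded.id hlog
    have hB : IsPBounded fun n => (n + 2 * (2 * (n * Nat.log 2 n) + 3)) * (8 * (n * n) + 8) :=
      IsPBounded.mul_holds
        (IsPBounded.add_holds IsPBounded.id (IsPBounded.mul_holds (IsPBounded.const 2)
          (IsPBounded.add_holds (IsPBounded.mul_holds (IsPBounded.const 2) hν) (IsPBounded.const 3))))
        (IsPBounded.add_holds (IsPBounded.mul_holds (IsPBounded.const 8)
          (IsPBounded.mul_holds IsPBounded.id IsPBounded.id)) (IsPBounded.const 8))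
    refine isVNPFamily_aeval_of_isPBounded
      (σ := fun n => Fin (2 * (n * Nat.log 2 n) + 3) ⊕ Fin (2 * (n * Nat.log 2 n) + 3))
      (τ := fun n => Fin n)
      (isVNPFamily_map_of_isProjection_perPoly (σ := fun n =>
          Fin (2 * (n * Nat.log 2 n) + 3) ⊕ Fin (2 * (n * Nat.log 2 n) + 3))
        (q := fun n => q (n * Nat.log 2 n)) (IsPBounded.comp_holds hq hν) ?_
        (fun n => h (n * Nat.log 2 n)) fun n => hproj (n * Nat.log 2 n))
      (fun n v => MvPolynomial.map (algebraMap ℝ ℂ) (g n v)) hB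
      (fun n => ?_) (fun n => ?_) (fun n v => ?_)
    · -- number of variables of `h_ν`
      refine (IsPBounded.add_holds (IsPBounded.add_holds (IsPBounded.mul_holds (IsPBounded.const 2) hν)
        (IsPBounded.const 3)) (IsPBounded.add_holds (IsPBounded.mul_holds (IsPBounded.const 2) hν)
        (IsPBounded.const 3))).mono fun n => ?_
      rw [Fintype.card_sum, Fintype.card_fin]
    · -- number of variables of `Θ_n`
      rw [Fintype.card_fin]
      have : 1 ≤ 8 * (n * n) + 8 := by omega
      calc n ≤ n + 2 * (2 * (n * Nat.log 2 n) + 3) := Nat.le_add_right _ _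
        _ = (n + 2 * (2 * (n * Nat.log 2 n) + 3)) * 1 := (mul_one _).symm
        _ ≤ _ := Nat.mul_le_mul_left _ this
    · -- total cost of the substitution
      calc ∑ v, complexity (MvPolynomial.map (algebraMap ℝ ℂ) (g n v))
          ≤ ∑ _v : Fin (2 * (n * Nat.log 2 n) + 3) ⊕ Fin (2 * (n * Nat.log 2 n) + 3),
              2 ^ (2 * Nat.log 2 n + 3) := Finset.sum_le_sum fun v _ => hgcx n v
        _ = (2 * (2 * (n * Nat.log 2 n) + 3)) * 2 ^ (2 * Nat.log 2 n + 3) := by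
          rw [Finset.sum_const, Finset.card_univ, Fintype.card_sum, Fintype.card_fin, smul_eq_mul]
          ring
        _ ≤ (n + 2 * (2 * (n * Nat.log 2 n) + 3)) * (8 * (n * n) + 8) :=
          Nat.mul_le_mul (Nat.le_add_left _ _) (hβ n)
    · -- degrees of the substituted values
      calc (MvPolynomial.map (algebraMap ℝ ℂ) (g n v)).totalDegree ≤ 2 ^ (2 * Nat.log 2 n + 3) :=
            hgdeg n v
        _ ≤ 8 * (n * n) + 8 := hβ n
        _ = 1 * (8 * (n * n) + 8) := (one_mul _).symm
        _ ≤ (n + 2 * (2 * (n * Nat.log 2 n) + 3)) * (8 * (n * n) + 8) :=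
          Nat.mul_le_mul_right _ (by omega)
  · /- roots: the restriction along `y_i = X^{2^{β i}}` is `V_ν`, `ν = n ⌊log₂ n⌋` -/
    have hm : 2 * (n * Nat.log 2 n) + 3 ≤ (2 * Nat.log 2 n + 3) * n := by nlinarith
    have hP : aeval (fun i : Fin n => (Polynomial.X : Polynomial ℝ) ^ 2 ^ ((2 * Nat.log 2 n + 3) * (i : ℕ)))
        (aeval (g n) (MvPolynomial.map (algebraMap ℚ ℝ) (h (n * Nat.log 2 n)))) =
        (tavenasV (n * Nat.log 2 n)).map (Int.castRingHom ℝ) := by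
      apply Polynomial.funext
      intro x
      rw [← eval_map_tavenas_h (hsub (n * Nat.log 2 n)) x, ← Polynomial.coe_aeval_eq_eval,
        comp_aeval_apply, comp_aeval_apply, MvPolynomial.aeval_eq_eval]
      have hF : (fun v => aeval (fun i : Fin n => Polynomial.aeval x
            ((Polynomial.X : Polynomial ℝ) ^ 2 ^ ((2 * Nat.log 2 n + 3) * (i : ℕ)))) (g n v)) =
          Sum.elim (fun j : Fin (2 * (n * Nat.log 2 n) + 3) => x ^ 2 ^ (j : ℕ))
            (fun i : Fin (2 * (n * Nat.log 2 n) + 3) => (2 : ℝ) ^ 2 ^ (i : ℕ)) := by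
        funext v
        rw [← hgev n hm x v, MvPolynomial.aeval_eq_eval]
        have hpt : (fun i : Fin n => Polynomial.aeval x
            ((Polynomial.X : Polynomial ℝ) ^ 2 ^ ((2 * Nat.log 2 n + 3) * (i : ℕ)))) =
            fun i : Fin n => x ^ 2 ^ ((2 * Nat.log 2 n + 3) * (i : ℕ)) := by
          funext i
          simp only [map_pow, Polynomial.aeval_X]
        rw [hpt]
      rw [hF]
    rw [hP]
    have hr := le_card_roots_toFinset_map_tavenasV (n * Nat.log 2 n)
    have h1 : 1 ≤ 2 ^ (n * Nat.log 2 n) := Nat.one_le_two_pow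
    omega

end Summit.ValiantsHypothesis.ValiantsHypothesis.Theorems.LacunarySymmetroid

end
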